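import Summits.Ventures.PercRepro.Night2FatBudget
import Summits.Ventures.PercRepro.Night2SeriesClassFourCellsB

/-!
# PercRepro — the fat covering preimages of a target are few (night-2, gen 24)

A covering preimage `B` of a target `S` is `S ∖ z` for the one point `z ∈ S` outside `cl B`
(`coverPreimage_eq_erase`); two covering preimages of `S` with the same closure coincide
(`clF_injOn_coverPreimages`: `z' ∈ S ∖ z = B ⊆ cl B = cl B'` but `z' ∉ cl B'`).  Hence

* **`card_fat_coverPreimages_le_card_fatClosures`**: the thin covering preimages of `S` missing `≤ 2` points are at
  most `#fatClosures M q G 2`;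
* **`card_inter_eq_one_of_fat_coverPreimage`**: a fat covering preimage with missed pair `P` meets `S` in exactly
  one point of `P` (`S ∩ P = {z}`);
* **`card_fat_coverPreimages_le_two_of_triangle`**: when every fat missed set is one of `{p, x}`, `{p, y}`,
  `{x, y}`, a target has at most TWO fat covering preimages — three would give
  `|S ∩ {p,x}| + |S ∩ {p,y}| + |S ∩ {x,y}| = 3 = 2·|S ∩ {p,x,y}|` (`card_inter_pair_add_eq`), odd against even.

These feed the fat-face capacity `cPrimeFat` of `Night2FatFaceCap` at the `(3, 1)` survivor cells.
-/

namespace PercRepro.Shadow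

open Finset PerFlat ThmH

variable {α : Type*} [DecidableEq α] {M : Matroid α} [M.Finite]

/-- A covering preimage `B` of `S` is `S ∖ z` for a point `z ∈ S` with `z ∈ G ∖ cl B`. -/
theorem coverPreimage_eq_erase {q : ℕ} {G S B : Finset α}
    (hB : B ∈ coverPreimages M (Uq M (q + 2) q) G S) :
    ∃ z ∈ S, z ∈ G \ clF M B ∧ B = S.erase z := by
  rw [mem_coverPreimages] at hB
  obtain ⟨z, hz, hzS⟩ := mem_coverSets.1 hB.2
  have hBU : B ∈ Uq M (q + 2) q := (mem_membersIn.1 hB.1).1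
  have hzB : z ∉ B := notMem_of_notMem_clF hBU (Finset.mem_sdiff.1 hz).2
  refine ⟨z, ?_, hz, ?_⟩
  · rw [← hzS]; exact Finset.mem_insert_self z B
  · rw [← hzS, Finset.erase_insert hzB]

/-- A member of `Uq` lies in the ground set. -/
theorem subset_gr_of_mem_Uq {p q : ℕ} {B : Finset α} (hB : B ∈ Uq M p q) : B ⊆ gr M := by
  unfold Uq at hB
  rw [Finset.mem_filter, Finset.mem_powerset] at hB
  exact hB.1

/-- **Two covering preimages of `S` with the same closure coincide.** -/
theorem clF_injOn_coverPreimages {q : ℕ} {G S B B' : Finset α}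
    (hB : B ∈ coverPreimages M (Uq M (q + 2) q) G S) (hB' : B' ∈ coverPreimages M (Uq M (q + 2) q) G S)
    (heq : clF M B = clF M B') : B = B' := by
  obtain ⟨z, hzS, hz, rfl⟩ := coverPreimage_eq_erase hB
  obtain ⟨z', hzS', hz', rfl⟩ := coverPreimage_eq_erase hB'
  by_cases hzz : z = z'
  · rw [hzz]
  · exfalso
    -- `z' ∈ S ∖ z ⊆ cl (S ∖ z) = cl (S ∖ z')`, but `z' ∉ cl (S ∖ z')`
    have hBU : S.erase z ∈ Uq M (q + 2) q := (mem_membersIn.1 (mem_coverPreimages.1 hB).1).1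
    have h1 : z' ∈ clF M (S.erase z) :=
      subset_clF_of_subset_gr (subset_gr_of_mem_Uq hBU) (Finset.mem_erase.2 ⟨fun h => hzz h.symm, hzS'⟩)
    rw [heq] at h1
    exact (Finset.mem_sdiff.1 hz').2 h1

open scoped Classical in
/-- **The fat thin covering preimages of a target inject into the fat thin closures of `G`.** -/
theorem card_fat_coverPreimages_le_card_fatClosures {q : ℕ} {G S : Finset α} (m : ℕ) :
    ((coverPreimages M (Uq M (q + 2) q) G S).filter
      (fun B => B ∉ lay0 M q G ∧ (G \ clF M B).card ≤ m)).card ≤ (fatClosures M q G m).card := by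
  apply Finset.card_le_card_of_injOn (fun B => clF M B)
  · intro B hB
    rw [Finset.mem_coe, Finset.mem_filter, mem_coverPreimages] at hB
    unfold fatClosures
    rw [Finset.mem_coe, Finset.mem_image]
    exact ⟨B, Finset.mem_filter.2 ⟨mem_thinMembers.2 ⟨hB.1.1, hB.2.1⟩, hB.2.2⟩, rfl⟩
  · intro B hB B' hB' heq
    rw [Finset.mem_coe, Finset.mem_filter] at hB hB'
    exact clF_injOn_coverPreimages hB.1 hB'.1 heq

/-- **A fat covering preimage with missed set `P` meets `S` in exactly one point**: `S ∩ P = {z}` for the one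
point `z ∈ S ∖ cl B`. -/
theorem card_inter_eq_one_of_fat_coverPreimage {q : ℕ} {G S B P : Finset α}
    (hB : B ∈ coverPreimages M (Uq M (q + 2) q) G S) (hP : G \ clF M B = P) (hSG : S ⊆ G) :
    (S ∩ P).card = 1 := by
  obtain ⟨z, hzS, hz, rfl⟩ := coverPreimage_eq_erase hB
  have hBU : S.erase z ∈ Uq M (q + 2) q := (mem_membersIn.1 (mem_coverPreimages.1 hB).1).1
  have : S ∩ P = {z} := by
    ext w
    rw [Finset.mem_inter, Finset.mem_singleton, ← hP, Finset.mem_sdiff]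
    constructor
    · rintro ⟨hwS, -, hwc⟩
      by_contra hwz
      exact hwc (subset_clF_of_subset_gr (subset_gr_of_mem_Uq hBU) (Finset.mem_erase.2 ⟨hwz, hwS⟩))
    · rintro rfl
      exact ⟨hzS, hSG hzS, (Finset.mem_sdiff.1 hz).2⟩
  rw [this, Finset.card_singleton]

open scoped Classical in
/-- **At most two fat covering preimages when the fat missed sets form a triangle**: if every thin member missing
`≤ 2` points misses one of `{p, x}`, `{p, y}`, `{x, y}`, no target `S ⊆ G` has three thin covering preimages missing
`≤ 2` points (parity: `|S ∩ {p,x}| + |S ∩ {p,y}| + |S ∩ {x,y}| = 2·|S ∩ {p,x,y}|`). -/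
theorem card_fat_coverPreimages_le_two_of_triangle {q : ℕ} {G S : Finset α} (hSG : S ⊆ G) {p x y : α}
    (hpx : p ≠ x) (hpy : p ≠ y) (hxy : x ≠ y)
    (htri : ∀ B ∈ thinMembers M q G, (G \ clF M B).card ≤ 2 →
      G \ clF M B = {p, x} ∨ G \ clF M B = {p, y} ∨ G \ clF M B = {x, y}) :
    ((coverPreimages M (Uq M (q + 2) q) G S).filter
      (fun B => B ∉ lay0 M q G ∧ (G \ clF M B).card ≤ 2)).card ≤ 2 := by
  set F := (coverPreimages M (Uq M (q + 2) q) G S).filter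
    (fun B => B ∉ lay0 M q G ∧ (G \ clF M B).card ≤ 2) with hF
  by_contra hcon
  push Not at hcon
  obtain ⟨B₀, B₁, B₂, h0, h1, h2, h01, h02, h12⟩ := Finset.two_lt_card_iff.1 hcon
  have hmem : ∀ B ∈ F, B ∈ coverPreimages M (Uq M (q + 2) q) G S ∧ B ∈ thinMembers M q G ∧
      (G \ clF M B).card ≤ 2 := by
    intro B hB
    rw [hF, Finset.mem_filter] at hB
    exact ⟨hB.1, mem_thinMembers.2 ⟨(mem_coverPreimages.1 hB.1).1, hB.2.1⟩, hB.2.2⟩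
  -- distinct preimages have distinct missed sets
  have hne : ∀ B ∈ F, ∀ B' ∈ F, B ≠ B' → G \ clF M B ≠ G \ clF M B' := by
    intro B hB B' hB' hBB' heq
    apply hBB'
    apply clF_injOn_coverPreimages (hmem B hB).1 (hmem B' hB').1
    rw [clF_eq_sdiff_sdiff_of_thin (hmem B hB).2.1, clF_eq_sdiff_sdiff_of_thin (hmem B' hB').2.1, heq]
  -- the three missed sets are the three pairs of the triangle, in some order
  have hT : ∀ Q : Finset α, Q = {p, x} ∨ Q = {p, y} ∨ Q = {x, y} →
      ∃ B ∈ F, G \ clF M B = Q := by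
    intro Q hQ
    have e0 := htri B₀ (hmem B₀ h0).2.1 (hmem B₀ h0).2.2
    have e1 := htri B₁ (hmem B₁ h1).2.1 (hmem B₁ h1).2.2
    have e2 := htri B₂ (hmem B₂ h2).2.1 (hmem B₂ h2).2.2
    have n01 := hne B₀ h0 B₁ h1 h01
    have n02 := hne B₀ h0 B₂ h2 h02
    have n12 := hne B₁ h1 B₂ h2 h12
    rcases e0 with e0 | e0 | e0 <;> rcases e1 with e1 | e1 | e1 <;> rcases e2 with e2 | e2 | e2 <;>
      first
      | exact absurd (e0.trans e1.symm) n01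
      | exact absurd (e0.trans e2.symm) n02
      | exact absurd (e1.trans e2.symm) n12
      | (rcases hQ with rfl | rfl | rfl <;>
          first
          | exact ⟨B₀, h0, e0⟩
          | exact ⟨B₁, h1, e1⟩
          | exact ⟨B₂, h2, e2⟩)
  obtain ⟨C₀, hC₀, hP₀⟩ := hT {p, x} (Or.inl rfl)
  obtain ⟨C₁, hC₁, hP₁⟩ := hT {p, y} (Or.inr (Or.inl rfl))
  obtain ⟨C₂, hC₂, hP₂⟩ := hT {x, y} (Or.inr (Or.inr rfl))
  have k0 := card_inter_eq_one_of_fat_coverPreimage (hmem C₀ hC₀).1 hP₀ hSG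
  have k1 := card_inter_eq_one_of_fat_coverPreimage (hmem C₁ hC₁).1 hP₁ hSG
  have k2 := card_inter_eq_one_of_fat_coverPreimage (hmem C₂ hC₂).1 hP₂ hSG
  have := card_inter_pair_add_eq S hpx hpy hxy
  omega

end PercRepro.Shadow
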